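import Summits.QuantumFields.YangMills.Theorems.BalabanUVNodesN16HolderMSAtRecord13CoP
import Summits.QuantumFields.YangMills.Theorems.BalabanUVNodesN16SlotWindowAllTorus

/-!
# Route «BalabanUVNodes», cluster K4 «SpineRates» — node N16 = NE3: ★ THE N16 LINES AT dag-n22-e's STAGE-13 RATE HOMES `RRec₁₃CoPOn 𝔯 Rg` ∕ `RRec₁₃CoP 𝔯` AND AT THE NAMED READING
# OF RECORD `readingOfRecord₁₃CoP w1 ℓ ne2 ne1` (binder `θ.Provisos₁₃Core F N`), WITH NODE N05's CONJUNCTS AT THE PINNED ALL-TORUS PROPER SUB-INDEX (R-b″ on N16's record side) —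
# three currencies (β = 1 the stub of record `S_N16` · R-β `S_N16Holder β` · R-β″ `S_N16HolderMS β`), each at the regime-restricted and at the canonical home

Cell `pub-ymgap`, seat `pub-ymgap-dag-n16-e` (R134 acceleration seat (a), strategy s2 = BY-NAME KNIT at the record; HUMAN RULING D-0062; chair R424 venue), generation 7,
module 36 (THEOREMS ONLY, 0 `def`, 0 `sorry`, standard axioms).  `--kind proof --supports <K3 id of record> --as helper` (v1.5 CoP: stmt-QuantumFields-20296, WORDS-141).  `bears_on: R4∕N16 · edges N05 → N16, N07 → N16 ·
out-edge N16 → N21 (the K3 composer's `h16`)`.  Over this seat's home modules `…N16AtRRec13CoP` ∕ `…N16AtRRec13CoPLines` ∕ `…N16HolderMSAtRecord13CoP` (the constant-layer iffs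
`s_N16(Holder)(MS)_rRec₁₃CoP(On)_iff_ofRecord ∕ _iff_of_constLayer`, through them dag-n22-e's `…RateCarriersOfRecord13CoP(On)` ∕ `…RateReadingOfRecord13CoP`) and the AT kit:
module 33 `…N16SlotWindowAllTorus` (the STAGE-FREE per-family lemmas) + module 32 `…N16LeafSlotAllTorus` (the closers).  Statements = this seat's landed ★ lines at these homes
(`…_of_window_linear`) with the N05 family's index subtype swapped to `{i : ZdIdx 4 F.L // (∀ j, i.Ω j = univ) ∧ (∀ m j, i.Λs m j = {y | j = m}) ∧ (∀ m j, i.Λb m j = {c | j = m})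
∧ i.η = ((F.L : ℝ)⁻¹) ^ i.k}` (dag-n16-c's PINNED key, F47∕F48); suffix `_allTorus`.  Restates nothing.

WHY (LOCATED-4 of this seat; modules 32–35).  The landed ★ lines ask N05's conclusion at EVERY member of the univ sub-family, which no printed supplier serves at the
degenerate members and whose `Prop3Body` conjunct dag-n16-c's F49 `not_prop3Printed_zdGF3_univ` REFUTES (the univ-keyed ★ lines are VACUOUS as stated); these are the same lines with the N05 conjunct n16-c's R-b″ tops ∕ n05-a's per-member currency over `IdxB8SubB` actually produce —
WEAKER hypotheses, hence STRONGER theorems; the K3 composer's `h16 : S_N16 (RRec₁₃CoPOn (readingOfRecord₁₃CoP w1 ℓ₃ ne2 ne1) Rg)` is §2's conclusion verbatim.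

CONTENT.  §1 (`hpin`-generic reading `𝔯`): ★ `s_N16_rRec₁₃CoPOn_ofRecord_of_window_linear_allTorus` · `s_N16_rRec₁₃CoP_ofRecord_of_window_linear_allTorus` ·
`s_N16Holder_rRec₁₃CoP(On)_ofRecord_of_window_linear_allTorus` · `s_N16HolderMS_rRec₁₃CoP(On)_ofRecord_of_window_linear_allTorus`; §2 (named reading): ★
`s_N16_readingOfRecord₁₃CoP(On)_of_window_linear_allTorus` · `s_N16Holder_readingOfRecord₁₃CoP(On)_of_window_linear_allTorus` · `s_N16HolderMS_readingOfRecord₁₃CoP(On)_of_window_linear_allTorus`.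

HONEST FRAMING.  Kernel bookkeeping by name; no estimate; N05's `Thm4Body` ∕ `Prop3Body` ([Balaban1985RegularSpaces] Thm 4 ∕ Prop 3 TYPES at the pinned all-torus proper members)
and N07's `LeafH3sup` ([Balaban1985Variational] Thm 1 (8)+(10) TYPE) are HYPOTHESES asserted for no family; `𝔯` ∕ `w1` ∕ `ne2` ∕ `ne1` ∕ the letters are PARAMETERS ∕ residual DATA;
no admissible Stage-13 tuple of this edition is claimed to exist (K0 OPEN); the (42)∕(0.4) averaging transfer (N21's `hdict`) and the Hölder-pin ruling untouched; nothing of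
Bałaban's asserted; **N16 ∕ NE3 is NOT discharged**; count-neutral (typed 28∕28 · discharged 5∕27, A 5∕28 UNMOVED); one finite four-torus at fixed ε — NOT ℝ⁴, NOT infinite volume,
NOT OS, NOT a mass gap, NOT Clay.
-/

set_option autoImplicit false

open scoped BigOperators Matrix Matrix.Norms.L2Operator
open NormedSpace

namespace Summit.QuantumFields.YangMills.BalabanUVNodes.N16LinesAllTorusAtRecord13CoP

open Literature.MathematicalPhysics.QuantumFieldTheory.Balaban1983to89
open Literature.MathematicalPhysics.QuantumFieldTheory.Balaban1983to89.T4Continuum (T4Family ULoop)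
open B7Prop1Explicit B7Prop2Explicit
open B7Prop3Flat (c3)
open B8LeafModelZd (ZdIdx)
open B8LeafModelZd3 (zdGF3)
open Node00 (IsDatumOfRecord₁₃CCoP Stage13Params NE3Objects₁₁ NE3Letters₁₁ NE2Objects₁₁ ne3ConstLayerOfRecord₁₁ ne3NperOfRecord₁₁ ne3DomOfRecord₁₁ MatA)
open Node00.W1 (ReadingData)
open Summit.QuantumFields.BalabanUV.T4Continuum
open BlockAverageCurrent (curConst)
open NE3RightInverseSupLetters (frameC)
open NE3.LeafIndexSockets (LeafH3sup)
open YMDAG.UVSplit (Datum NE3Carriers NE1pCarriers N16At S_N16 ne3OfRecord₁₁ RateReading₁₃CoP RRec₁₃CoP RRec₁₃CoPOn readingOfRecord₁₃CoP readingOfRecord₁₃CoP_ne3)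
open Summit.QuantumFields.YangMills.BalabanUVNodes.N16Regime (radiusOfRecord constOfRecord)
open Summit.QuantumFields.YangMills.BalabanUVNodes.N16HolderDefs (S_N16Holder)
open Summit.QuantumFields.YangMills.BalabanUVNodes.N16HolderMSDefs (S_N16HolderMS)
open Summit.QuantumFields.YangMills.BalabanUVNodes.N16HolderRegime (radiusOfRecordH constOfRecordH)
open Summit.QuantumFields.YangMills.BalabanUVNodes.N16HolderMSRegime (radiusOfRecordHMS constOfRecordHMS)
open Summit.QuantumFields.YangMills.BalabanUVNodes.N16AtRRec13CoP (s_N16_rRec₁₃CoPOn_iff_ofRecord s_N16_rRec₁₃CoP_iff_of_constLayer)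
open Summit.QuantumFields.YangMills.BalabanUVNodes.N16AtRRec13CoPLines (s_N16Holder_rRec₁₃CoPOn_iff_ofRecord s_N16Holder_rRec₁₃CoP_iff_of_constLayer)
open Summit.QuantumFields.YangMills.BalabanUVNodes.N16HolderMSAtRecord13CoP (s_N16HolderMS_rRec₁₃CoPOn_iff_ofRecord s_N16HolderMS_rRec₁₃CoP_iff_ofRecord)
open Summit.QuantumFields.YangMills.BalabanUVNodes.N16LeafSlotAllTorus (n16At_of_inEndRegime_leafSlotAT n16HolderAt_of_inEndRegimeH_leafSlotHolderAT
  n16HolderMSAt_of_inEndRegimeHMS_leafSlotHolderMSAT)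
open Summit.QuantumFields.YangMills.BalabanUVNodes.N16SlotWindowAllTorus (inEndRegime_and_leafSlotAT_ofRecord_of_window_linear
  inEndRegimeH_and_leafSlotHolderAT_ofRecord_of_window_linear inEndRegimeHMS_and_leafSlotHolderMSAT_ofRecord_of_window_linear)

noncomputable section

variable {N : ℕ} [NeZero N] (β : ℝ) (𝔯 : RateReading₁₃CoP N) (Rg : (F : T4Family) → Stage13Params F N → Prop) (ℓ : T4Family → NE3Letters₁₁)

/-! Each section: ★ at the Stage-13 rate homes for a reading `𝔯` pinned at RR-1's object of record (`hpin`-generic), then at dag-n22-e's NAMED reading of record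
`readingOfRecord₁₃CoP w1 ℓ ne2 ne1` (`hpin := readingOfRecord₁₃CoP_ne3`, `rfl`). -/

variable (hpin : ∀ (F : T4Family) (θ : Stage13Params F N) (hP : θ.Provisos₁₃Core F N) (g₀ : ℕ → ℝ) (os : List (ULoop F)) (k : ℕ),
    (𝔯.lit F θ hP g₀ os).ne3 k = ne3ConstLayerOfRecord₁₁ F N (ℓ F))
  (w1 : (F : T4Family) → (θ : Stage13Params F N) → ReadingData F (MatA N) θ.τ9.M)
  (ne2 : (F : T4Family) → Stage13Params F N → (ℕ → ℝ) → List (ULoop F) → ℕ → NE2Objects₁₁)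
  (ne1 : (F : T4Family) → Stage13Params F N → (ℕ → ℝ) → List (ULoop F) → NE1pCarriers)

/-! ## §1 β = 1 — the stub of record `S_N16` -/

section One

variable
  {len : T4Family → Site 4 → ℝ} {c₁ c₁' B₁' cP C₂ B₀β : T4Family → ℝ} {inp : T4Family → B8.B9Inputs} {α b' c' : T4Family → ℝ}
  (hlen : ∀ (F : T4Family) (v : Site 4), 0 < len F v → 1 ≤ len F v) (hlen1 : ∀ (F : T4Family) (μ : Fin 4), len F (e μ) = 1)
  (hB₁' : ∀ F, 0 < B₁' F) (hBB : ∀ F : T4Family, 5 * ((4 : ℕ) : ℝ) * F.L * (inp F).B₀ ≤ B₁' F) (hc₁' : ∀ F, 0 < c₁' F)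
  (hwin : ∀ (F : T4Family) (α₀ α₁ : ℝ), 0 < α₀ → 0 < α₁ → α₀ + α₁ ≤ c₁' F →
    α₀ + α₁ ≤ c₁ F ∧ C0 4 * (2 * α₀) ≤ 1 / 3 ∧ 4 * α₀ ≤ c2' 4 F.L ∧ 16 * (B₁' F * (α₀ + α₁)) ≤ 1 ∧
    Real.exp (4 * (800 * (((4 : ℕ) : ℝ) + 1) ^ 2 * (((4 : ℕ) : ℝ) + 4)) * α₀) * (1 + 8 * (131072 * (((4 : ℕ) : ℝ) + 1) ^ 2) * (B₁' F * (α₀ + α₁))) ≤ 2 ∧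
    2 * (B₁' F * (α₀ + α₁)) ≤ c3 4 F.L ∧ ((4 : ℕ) : ℝ) * F.L * α₁ ≤ 1 / 8 ∧ α₀ ≤ cP F ∧ α₁ ≤ cP F ∧ B₁' F * (α₀ + α₁) ≤ cP F ∧
    2 * (B₁' F * (α₀ + α₁)) ^ 2 + 20 * ((4 : ℕ) : ℝ) * α₀ * (B₁' F * (α₀ + α₁)) + 2 * C₂ F * (B₁' F * (α₀ + α₁)) ^ 2 ≤ α₀ + α₁)
  (hα : ∀ F, 0 < α F) (hα1 : ∀ F, α F ≤ c₁' F / 177)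
  (hα2 : ∀ F : T4Family, α F ≤ (ℓ F).Λ₁ / (1770 * (5 * ((4 : ℕ) : ℝ) * F.L * (inp F).B₀) + 1))
  (hα3 : ∀ F : T4Family, α F ≤ c2' 4 F.L / 2)
  (hα4 : ∀ F : T4Family, α F ≤ 1 / ((23040 * (4 : ℝ) ^ 4 * (frameC 4 F.L + 4) ^ 3 + 12) * (1 + curConst 4 F.L) + 1))
  (hα5 : ∀ F, α F ≤ 1 / 10 ^ 9)
  (hg : ∀ F, 0 < (ℓ F).g) (hε0 : ∀ F, 0 < (ℓ F).ε) (hε : ∀ F, (ℓ F).ε < α F)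
  (hΛ₁r : ∀ F : T4Family, (ℓ F).Λ₁ ≤ radiusOfRecord N F.L (ne3NperOfRecord₁₁ F 0 0))
  (hb : ∀ F, 0 ≤ (ℓ F).b ∧ (ℓ F).b ≤ (ℓ F).ε / 2) (hC : ∀ F : T4Family, constOfRecord N F.L (ne3NperOfRecord₁₁ F 0 0) (ℓ F).g ≤ (ℓ F).C)
  (hΛ₂' : ∀ F : T4Family, 177 * α F * (5 * ((4 : ℕ) : ℝ) * F.L * B₀β F + 5 * ((4 : ℕ) : ℝ) * F.L * (inp F).B₀) ≤ (ℓ F).Λ₂')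
  (hb' : ∀ F, 0 ≤ b' F ∧ b' F ≤ α F / 2048) (hc' : ∀ F, 0 ≤ c' F ∧ c' F ≤ α F / 24)
include hpin hlen hlen1 hB₁' hBB hc₁' hwin hα hα1 hα2 hα3 hα4 hα5 hg hε0 hε hΛ₁r hb hC hΛ₂' hb' hc'

/-- ★ **THE N16 LINE (β = 1, the stub of record `S_N16`) AT THE REGIME-RESTRICTED home (content once per GUARDED family carrying an admissible tuple), a reading `𝔯` pinned at RR-1's object of record (`hpin`), N05's CONJUNCTS AT THE PINNED ALL-TORUS PROPER SUB-INDEX** — the three content clauses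
once per family give `S_N16 (RRec₁₃CoPOn 𝔯 Rg)`; every other hypothesis a displayed letter line (module 33's per-family lemma, module 32's closer, the home's constant-layer iff). [folklore] -/
theorem s_N16_rRec₁₃CoPOn_ofRecord_of_window_linear_allTorus
    (hcontent : ∀ (F : T4Family), (∃ θ : Stage13Params F N, θ.Provisos₁₃Core F N ∧ Rg F θ ∧ θ.Admissible F N) →
      letI : CStarAlgebra (Matrix (Fin N) (Fin N) ℂ) := {}
      B8.Thm4Body (c₁ F) (B₁' F) (fun i : {i : ZdIdx 4 F.L // (∀ j, i.Ω j = Set.univ) ∧ (∀ m j, i.Λs m j = {_y | j = m}) ∧ (∀ m j, i.Λb m j = {_c | j = m}) ∧ i.η = ((F.L : ℝ)⁻¹) ^ i.k} => (zdGF3 (Matrix (Fin N) (Fin N) ℂ) F.L 1 (len F) i.1).toGFData) ∧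
        B8.Prop3Body (cP F) 4 (F.L : ℝ) (C₂ F) (inp F) (B₀β F)
          (fun i : {i : ZdIdx 4 F.L // (∀ j, i.Ω j = Set.univ) ∧ (∀ m j, i.Λs m j = {_y | j = m}) ∧ (∀ m j, i.Λb m j = {_c | j = m}) ∧ i.η = ((F.L : ℝ)⁻¹) ^ i.k} => (zdGF3 (Matrix (Fin N) (Fin N) ℂ) F.L 1 (len F) i.1).toGFData2) ∧
        LeafH3sup 4 F.L (ne3NperOfRecord₁₁ F 0 0) (ℓ F).ε (b' F) (c' F) (ne3DomOfRecord₁₁ F N 0 0)) :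
    S_N16 (RRec₁₃CoPOn 𝔯 Rg) :=
  (s_N16_rRec₁₃CoPOn_iff_ofRecord 𝔯 Rg ℓ hpin).2 fun F hF =>
    have h := inEndRegime_and_leafSlotAT_ofRecord_of_window_linear ℓ hlen hlen1 hB₁' hBB hc₁' hwin hα hα1 hα2 hα3 hα4 hα5 hg hε0 hε hΛ₁r hb hC hΛ₂' hb' hc' F
      (hcontent F hF).1 (hcontent F hF).2.1 (hcontent F hF).2.2
    n16At_of_inEndRegime_leafSlotAT h.1 h.2

/-- ★ **THE N16 LINE (β = 1, the stub of record `S_N16`) AT THE CANONICAL home (content once per family carrying a Stage-13 datum of record), a reading `𝔯` pinned at RR-1's object of record (`hpin`), N05's CONJUNCTS AT THE PINNED ALL-TORUS PROPER SUB-INDEX** — the three content clauses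
once per family give `S_N16 (RRec₁₃CoP 𝔯)`; every other hypothesis a displayed letter line (module 33's per-family lemma, module 32's closer, the home's constant-layer iff). [folklore] -/
theorem s_N16_rRec₁₃CoP_ofRecord_of_window_linear_allTorus
    (hcontent : ∀ (F : T4Family), (∃ D : Datum F N, IsDatumOfRecord₁₃CCoP F N D) →
      letI : CStarAlgebra (Matrix (Fin N) (Fin N) ℂ) := {}
      B8.Thm4Body (c₁ F) (B₁' F) (fun i : {i : ZdIdx 4 F.L // (∀ j, i.Ω j = Set.univ) ∧ (∀ m j, i.Λs m j = {_y | j = m}) ∧ (∀ m j, i.Λb m j = {_c | j = m}) ∧ i.η = ((F.L : ℝ)⁻¹) ^ i.k} => (zdGF3 (Matrix (Fin N) (Fin N) ℂ) F.L 1 (len F) i.1).toGFData) ∧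
        B8.Prop3Body (cP F) 4 (F.L : ℝ) (C₂ F) (inp F) (B₀β F)
          (fun i : {i : ZdIdx 4 F.L // (∀ j, i.Ω j = Set.univ) ∧ (∀ m j, i.Λs m j = {_y | j = m}) ∧ (∀ m j, i.Λb m j = {_c | j = m}) ∧ i.η = ((F.L : ℝ)⁻¹) ^ i.k} => (zdGF3 (Matrix (Fin N) (Fin N) ℂ) F.L 1 (len F) i.1).toGFData2) ∧
        LeafH3sup 4 F.L (ne3NperOfRecord₁₁ F 0 0) (ℓ F).ε (b' F) (c' F) (ne3DomOfRecord₁₁ F N 0 0)) :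
    S_N16 (RRec₁₃CoP 𝔯) :=
  (s_N16_rRec₁₃CoP_iff_of_constLayer 𝔯 (fun F => ne3ConstLayerOfRecord₁₁ F N (ℓ F)) hpin).2 fun F hF =>
    have h := inEndRegime_and_leafSlotAT_ofRecord_of_window_linear ℓ hlen hlen1 hB₁' hBB hc₁' hwin hα hα1 hα2 hα3 hα4 hα5 hg hε0 hε hΛ₁r hb hC hΛ₂' hb' hc' F
      (hcontent F hF).1 (hcontent F hF).2.1 (hcontent F hF).2.2
    n16At_of_inEndRegime_leafSlotAT h.1 h.2

omit hpin in
/-- ★ **THE N16 LINE (β = 1, the stub of record `S_N16`) AT THE REGIME-RESTRICTED home (content once per GUARDED family carrying an admissible tuple), dag-n22-e's NAMED reading of record `readingOfRecord₁₃CoP w1 ℓ ne2 ne1` (`hpin := readingOfRecord₁₃CoP_ne3`, `rfl`), N05's CONJUNCTS AT THE PINNED ALL-TORUS PROPER SUB-INDEX** — the three content clauses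
once per family give `S_N16 (RRec₁₃CoPOn (readingOfRecord₁₃CoP w1 ℓ ne2 ne1) Rg)`; every other hypothesis a displayed letter line (module 33's per-family lemma, module 32's closer, the home's constant-layer iff). [folklore] -/
theorem s_N16_readingOfRecord₁₃CoPOn_of_window_linear_allTorus
    (hcontent : ∀ (F : T4Family), (∃ θ : Stage13Params F N, θ.Provisos₁₃Core F N ∧ Rg F θ ∧ θ.Admissible F N) →
      letI : CStarAlgebra (Matrix (Fin N) (Fin N) ℂ) := {}
      B8.Thm4Body (c₁ F) (B₁' F) (fun i : {i : ZdIdx 4 F.L // (∀ j, i.Ω j = Set.univ) ∧ (∀ m j, i.Λs m j = {_y | j = m}) ∧ (∀ m j, i.Λb m j = {_c | j = m}) ∧ i.η = ((F.L : ℝ)⁻¹) ^ i.k} => (zdGF3 (Matrix (Fin N) (Fin N) ℂ) F.L 1 (len F) i.1).toGFData) ∧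
        B8.Prop3Body (cP F) 4 (F.L : ℝ) (C₂ F) (inp F) (B₀β F)
          (fun i : {i : ZdIdx 4 F.L // (∀ j, i.Ω j = Set.univ) ∧ (∀ m j, i.Λs m j = {_y | j = m}) ∧ (∀ m j, i.Λb m j = {_c | j = m}) ∧ i.η = ((F.L : ℝ)⁻¹) ^ i.k} => (zdGF3 (Matrix (Fin N) (Fin N) ℂ) F.L 1 (len F) i.1).toGFData2) ∧
        LeafH3sup 4 F.L (ne3NperOfRecord₁₁ F 0 0) (ℓ F).ε (b' F) (c' F) (ne3DomOfRecord₁₁ F N 0 0)) :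
    S_N16 (RRec₁₃CoPOn (readingOfRecord₁₃CoP w1 ℓ ne2 ne1) Rg) :=
  (s_N16_rRec₁₃CoPOn_iff_ofRecord (readingOfRecord₁₃CoP w1 ℓ ne2 ne1) Rg ℓ (readingOfRecord₁₃CoP_ne3 w1 ℓ ne2 ne1)).2 fun F hF =>
    have h := inEndRegime_and_leafSlotAT_ofRecord_of_window_linear ℓ hlen hlen1 hB₁' hBB hc₁' hwin hα hα1 hα2 hα3 hα4 hα5 hg hε0 hε hΛ₁r hb hC hΛ₂' hb' hc' F
      (hcontent F hF).1 (hcontent F hF).2.1 (hcontent F hF).2.2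
    n16At_of_inEndRegime_leafSlotAT h.1 h.2

omit hpin in
/-- ★ **THE N16 LINE (β = 1, the stub of record `S_N16`) AT THE CANONICAL home (content once per family carrying a Stage-13 datum of record), dag-n22-e's NAMED reading of record `readingOfRecord₁₃CoP w1 ℓ ne2 ne1` (`hpin := readingOfRecord₁₃CoP_ne3`, `rfl`), N05's CONJUNCTS AT THE PINNED ALL-TORUS PROPER SUB-INDEX** — the three content clauses
once per family give `S_N16 (RRec₁₃CoP (readingOfRecord₁₃CoP w1 ℓ ne2 ne1))`; every other hypothesis a displayed letter line (module 33's per-family lemma, module 32's closer, the home's constant-layer iff). [folklore] -/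
theorem s_N16_readingOfRecord₁₃CoP_of_window_linear_allTorus
    (hcontent : ∀ (F : T4Family), (∃ D : Datum F N, IsDatumOfRecord₁₃CCoP F N D) →
      letI : CStarAlgebra (Matrix (Fin N) (Fin N) ℂ) := {}
      B8.Thm4Body (c₁ F) (B₁' F) (fun i : {i : ZdIdx 4 F.L // (∀ j, i.Ω j = Set.univ) ∧ (∀ m j, i.Λs m j = {_y | j = m}) ∧ (∀ m j, i.Λb m j = {_c | j = m}) ∧ i.η = ((F.L : ℝ)⁻¹) ^ i.k} => (zdGF3 (Matrix (Fin N) (Fin N) ℂ) F.L 1 (len F) i.1).toGFData) ∧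
        B8.Prop3Body (cP F) 4 (F.L : ℝ) (C₂ F) (inp F) (B₀β F)
          (fun i : {i : ZdIdx 4 F.L // (∀ j, i.Ω j = Set.univ) ∧ (∀ m j, i.Λs m j = {_y | j = m}) ∧ (∀ m j, i.Λb m j = {_c | j = m}) ∧ i.η = ((F.L : ℝ)⁻¹) ^ i.k} => (zdGF3 (Matrix (Fin N) (Fin N) ℂ) F.L 1 (len F) i.1).toGFData2) ∧
        LeafH3sup 4 F.L (ne3NperOfRecord₁₁ F 0 0) (ℓ F).ε (b' F) (c' F) (ne3DomOfRecord₁₁ F N 0 0)) :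
    S_N16 (RRec₁₃CoP (readingOfRecord₁₃CoP w1 ℓ ne2 ne1)) :=
  (s_N16_rRec₁₃CoP_iff_of_constLayer (readingOfRecord₁₃CoP w1 ℓ ne2 ne1) (fun F => ne3ConstLayerOfRecord₁₁ F N (ℓ F)) (readingOfRecord₁₃CoP_ne3 w1 ℓ ne2 ne1)).2 fun F hF =>
    have h := inEndRegime_and_leafSlotAT_ofRecord_of_window_linear ℓ hlen hlen1 hB₁' hBB hc₁' hwin hα hα1 hα2 hα3 hα4 hα5 hg hε0 hε hΛ₁r hb hC hΛ₂' hb' hc' F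
      (hcontent F hF).1 (hcontent F hF).2.1 (hcontent F hF).2.2
    n16At_of_inEndRegime_leafSlotAT h.1 h.2

end One

/-! ## §2 Exponent `β ∈ [0, 1]` — `S_N16Holder β` (R-β) -/

section Holder

variable
  {len : T4Family → Site 4 → ℝ} {c₁ c₁' B₁' cP C₂ B₀β : T4Family → ℝ} {inp : T4Family → B8.B9Inputs} {α b' c' : T4Family → ℝ}
  (hlen : ∀ (F : T4Family) (v : Site 4), 0 < len F v → 1 ≤ len F v) (hlen1 : ∀ (F : T4Family) (μ : Fin 4), len F (e μ) = 1)
  (hB₁' : ∀ F, 0 < B₁' F) (hBB : ∀ F : T4Family, 5 * ((4 : ℕ) : ℝ) * F.L * (inp F).B₀ ≤ B₁' F) (hc₁' : ∀ F, 0 < c₁' F)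
  (hwin : ∀ (F : T4Family) (α₀ α₁ : ℝ), 0 < α₀ → 0 < α₁ → α₀ + α₁ ≤ c₁' F →
    α₀ + α₁ ≤ c₁ F ∧ C0 4 * (2 * α₀) ≤ 1 / 3 ∧ 4 * α₀ ≤ c2' 4 F.L ∧ 16 * (B₁' F * (α₀ + α₁)) ≤ 1 ∧
    Real.exp (4 * (800 * (((4 : ℕ) : ℝ) + 1) ^ 2 * (((4 : ℕ) : ℝ) + 4)) * α₀) * (1 + 8 * (131072 * (((4 : ℕ) : ℝ) + 1) ^ 2) * (B₁' F * (α₀ + α₁))) ≤ 2 ∧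
    2 * (B₁' F * (α₀ + α₁)) ≤ c3 4 F.L ∧ ((4 : ℕ) : ℝ) * F.L * α₁ ≤ 1 / 8 ∧ α₀ ≤ cP F ∧ α₁ ≤ cP F ∧ B₁' F * (α₀ + α₁) ≤ cP F ∧
    2 * (B₁' F * (α₀ + α₁)) ^ 2 + 20 * ((4 : ℕ) : ℝ) * α₀ * (B₁' F * (α₀ + α₁)) + 2 * C₂ F * (B₁' F * (α₀ + α₁)) ^ 2 ≤ α₀ + α₁)
  (hα : ∀ F, 0 < α F) (hα1 : ∀ F, α F ≤ c₁' F / 177)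
  (hα2 : ∀ F : T4Family, α F ≤ (ℓ F).Λ₁ / (1770 * (5 * ((4 : ℕ) : ℝ) * F.L * (inp F).B₀) + 1))
  (hα3 : ∀ F : T4Family, α F ≤ c2' 4 F.L / 2)
  (hα4 : ∀ F : T4Family, α F ≤ 1 / ((23040 * (4 : ℝ) ^ 4 * (frameC 4 F.L + 4) ^ 3 + 12) * (1 + curConst 4 F.L) + 1))
  (hα5 : ∀ F, α F ≤ 1 / 10 ^ 9)
  (hg : ∀ F, 0 < (ℓ F).g) (hε0 : ∀ F, 0 < (ℓ F).ε) (hε : ∀ F, (ℓ F).ε < α F)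
  (hΛ₁r : ∀ F : T4Family, (ℓ F).Λ₁ ≤ radiusOfRecordH N F.L (ne3NperOfRecord₁₁ F 0 0))
  (hb : ∀ F, 0 ≤ (ℓ F).b ∧ (ℓ F).b ≤ (ℓ F).ε / 2) (hC : ∀ F : T4Family, constOfRecordH N F.L (ne3NperOfRecord₁₁ F 0 0) (ℓ F).g ≤ (ℓ F).C)
  (hΛ₂' : ∀ F : T4Family, 177 * α F * (5 * ((4 : ℕ) : ℝ) * F.L * B₀β F + 5 * ((4 : ℕ) : ℝ) * F.L * (inp F).B₀) ≤ (ℓ F).Λ₂')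
  (hb' : ∀ F, 0 ≤ b' F ∧ b' F ≤ α F / 2048) (hc' : ∀ F, 0 ≤ c' F ∧ c' F ≤ α F / 24)
include hpin hlen hlen1 hB₁' hBB hc₁' hwin hα hα1 hα2 hα3 hα4 hα5 hg hε0 hε hΛ₁r hb hC hΛ₂' hb' hc'

variable (hβ0 : 0 ≤ β) (hβ1 : β ≤ 1)
include hβ0 hβ1

/-- ★ **THE N16 LINE AT EXPONENT `β ∈ [0, 1]` (`S_N16Holder β`) AT THE REGIME-RESTRICTED home (content once per GUARDED family carrying an admissible tuple), a reading `𝔯` pinned at RR-1's object of record (`hpin`), N05's CONJUNCTS AT THE PINNED ALL-TORUS PROPER SUB-INDEX** — the three content clauses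
once per family give `S_N16Holder β (RRec₁₃CoPOn 𝔯 Rg)`; every other hypothesis a displayed letter line (module 33's per-family lemma, module 32's closer, the home's constant-layer iff). [folklore] -/
theorem s_N16Holder_rRec₁₃CoPOn_ofRecord_of_window_linear_allTorus
    (hcontent : ∀ (F : T4Family), (∃ θ : Stage13Params F N, θ.Provisos₁₃Core F N ∧ Rg F θ ∧ θ.Admissible F N) →
      letI : CStarAlgebra (Matrix (Fin N) (Fin N) ℂ) := {}
      B8.Thm4Body (c₁ F) (B₁' F) (fun i : {i : ZdIdx 4 F.L // (∀ j, i.Ω j = Set.univ) ∧ (∀ m j, i.Λs m j = {_y | j = m}) ∧ (∀ m j, i.Λb m j = {_c | j = m}) ∧ i.η = ((F.L : ℝ)⁻¹) ^ i.k} => (zdGF3 (Matrix (Fin N) (Fin N) ℂ) F.L β (len F) i.1).toGFData) ∧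
        B8.Prop3Body (cP F) 4 (F.L : ℝ) (C₂ F) (inp F) (B₀β F)
          (fun i : {i : ZdIdx 4 F.L // (∀ j, i.Ω j = Set.univ) ∧ (∀ m j, i.Λs m j = {_y | j = m}) ∧ (∀ m j, i.Λb m j = {_c | j = m}) ∧ i.η = ((F.L : ℝ)⁻¹) ^ i.k} => (zdGF3 (Matrix (Fin N) (Fin N) ℂ) F.L β (len F) i.1).toGFData2) ∧
        LeafH3sup 4 F.L (ne3NperOfRecord₁₁ F 0 0) (ℓ F).ε (b' F) (c' F) (ne3DomOfRecord₁₁ F N 0 0)) :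
    S_N16Holder β (RRec₁₃CoPOn 𝔯 Rg) :=
  (s_N16Holder_rRec₁₃CoPOn_iff_ofRecord β 𝔯 Rg ℓ hpin).2 fun F hF =>
    have h := inEndRegimeH_and_leafSlotHolderAT_ofRecord_of_window_linear ℓ hlen hlen1 hB₁' hBB hc₁' hwin hα hα1 hα2 hα3 hα4 hα5 hg hε0 hε hΛ₁r hb hC hΛ₂' hb' hc' F
      (hcontent F hF).1 (hcontent F hF).2.1 (hcontent F hF).2.2
    n16HolderAt_of_inEndRegimeH_leafSlotHolderAT h.1 hβ0 hβ1 h.2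

/-- ★ **THE N16 LINE AT EXPONENT `β ∈ [0, 1]` (`S_N16Holder β`) AT THE CANONICAL home (content once per family carrying a Stage-13 datum of record), a reading `𝔯` pinned at RR-1's object of record (`hpin`), N05's CONJUNCTS AT THE PINNED ALL-TORUS PROPER SUB-INDEX** — the three content clauses
once per family give `S_N16Holder β (RRec₁₃CoP 𝔯)`; every other hypothesis a displayed letter line (module 33's per-family lemma, module 32's closer, the home's constant-layer iff). [folklore] -/
theorem s_N16Holder_rRec₁₃CoP_ofRecord_of_window_linear_allTorus
    (hcontent : ∀ (F : T4Family), (∃ D : Datum F N, IsDatumOfRecord₁₃CCoP F N D) →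
      letI : CStarAlgebra (Matrix (Fin N) (Fin N) ℂ) := {}
      B8.Thm4Body (c₁ F) (B₁' F) (fun i : {i : ZdIdx 4 F.L // (∀ j, i.Ω j = Set.univ) ∧ (∀ m j, i.Λs m j = {_y | j = m}) ∧ (∀ m j, i.Λb m j = {_c | j = m}) ∧ i.η = ((F.L : ℝ)⁻¹) ^ i.k} => (zdGF3 (Matrix (Fin N) (Fin N) ℂ) F.L β (len F) i.1).toGFData) ∧
        B8.Prop3Body (cP F) 4 (F.L : ℝ) (C₂ F) (inp F) (B₀β F)
          (fun i : {i : ZdIdx 4 F.L // (∀ j, i.Ω j = Set.univ) ∧ (∀ m j, i.Λs m j = {_y | j = m}) ∧ (∀ m j, i.Λb m j = {_c | j = m}) ∧ i.η = ((F.L : ℝ)⁻¹) ^ i.k} => (zdGF3 (Matrix (Fin N) (Fin N) ℂ) F.L β (len F) i.1).toGFData2) ∧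
        LeafH3sup 4 F.L (ne3NperOfRecord₁₁ F 0 0) (ℓ F).ε (b' F) (c' F) (ne3DomOfRecord₁₁ F N 0 0)) :
    S_N16Holder β (RRec₁₃CoP 𝔯) :=
  (s_N16Holder_rRec₁₃CoP_iff_of_constLayer β 𝔯 (fun F => ne3ConstLayerOfRecord₁₁ F N (ℓ F)) hpin).2 fun F hF =>
    have h := inEndRegimeH_and_leafSlotHolderAT_ofRecord_of_window_linear ℓ hlen hlen1 hB₁' hBB hc₁' hwin hα hα1 hα2 hα3 hα4 hα5 hg hε0 hε hΛ₁r hb hC hΛ₂' hb' hc' F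
      (hcontent F hF).1 (hcontent F hF).2.1 (hcontent F hF).2.2
    n16HolderAt_of_inEndRegimeH_leafSlotHolderAT h.1 hβ0 hβ1 h.2

omit hpin in
/-- ★ **THE N16 LINE AT EXPONENT `β ∈ [0, 1]` (`S_N16Holder β`) AT THE REGIME-RESTRICTED home (content once per GUARDED family carrying an admissible tuple), dag-n22-e's NAMED reading of record `readingOfRecord₁₃CoP w1 ℓ ne2 ne1` (`hpin := readingOfRecord₁₃CoP_ne3`, `rfl`), N05's CONJUNCTS AT THE PINNED ALL-TORUS PROPER SUB-INDEX** — the three content clauses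
once per family give `S_N16Holder β (RRec₁₃CoPOn (readingOfRecord₁₃CoP w1 ℓ ne2 ne1) Rg)`; every other hypothesis a displayed letter line (module 33's per-family lemma, module 32's closer, the home's constant-layer iff). [folklore] -/
theorem s_N16Holder_readingOfRecord₁₃CoPOn_of_window_linear_allTorus
    (hcontent : ∀ (F : T4Family), (∃ θ : Stage13Params F N, θ.Provisos₁₃Core F N ∧ Rg F θ ∧ θ.Admissible F N) →
      letI : CStarAlgebra (Matrix (Fin N) (Fin N) ℂ) := {}
      B8.Thm4Body (c₁ F) (B₁' F) (fun i : {i : ZdIdx 4 F.L // (∀ j, i.Ω j = Set.univ) ∧ (∀ m j, i.Λs m j = {_y | j = m}) ∧ (∀ m j, i.Λb m j = {_c | j = m}) ∧ i.η = ((F.L : ℝ)⁻¹) ^ i.k} => (zdGF3 (Matrix (Fin N) (Fin N) ℂ) F.L β (len F) i.1).toGFData) ∧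
        B8.Prop3Body (cP F) 4 (F.L : ℝ) (C₂ F) (inp F) (B₀β F)
          (fun i : {i : ZdIdx 4 F.L // (∀ j, i.Ω j = Set.univ) ∧ (∀ m j, i.Λs m j = {_y | j = m}) ∧ (∀ m j, i.Λb m j = {_c | j = m}) ∧ i.η = ((F.L : ℝ)⁻¹) ^ i.k} => (zdGF3 (Matrix (Fin N) (Fin N) ℂ) F.L β (len F) i.1).toGFData2) ∧
        LeafH3sup 4 F.L (ne3NperOfRecord₁₁ F 0 0) (ℓ F).ε (b' F) (c' F) (ne3DomOfRecord₁₁ F N 0 0)) :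
    S_N16Holder β (RRec₁₃CoPOn (readingOfRecord₁₃CoP w1 ℓ ne2 ne1) Rg) :=
  (s_N16Holder_rRec₁₃CoPOn_iff_ofRecord β (readingOfRecord₁₃CoP w1 ℓ ne2 ne1) Rg ℓ (readingOfRecord₁₃CoP_ne3 w1 ℓ ne2 ne1)).2 fun F hF =>
    have h := inEndRegimeH_and_leafSlotHolderAT_ofRecord_of_window_linear ℓ hlen hlen1 hB₁' hBB hc₁' hwin hα hα1 hα2 hα3 hα4 hα5 hg hε0 hε hΛ₁r hb hC hΛ₂' hb' hc' F
      (hcontent F hF).1 (hcontent F hF).2.1 (hcontent F hF).2.2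
    n16HolderAt_of_inEndRegimeH_leafSlotHolderAT h.1 hβ0 hβ1 h.2

omit hpin in
/-- ★ **THE N16 LINE AT EXPONENT `β ∈ [0, 1]` (`S_N16Holder β`) AT THE CANONICAL home (content once per family carrying a Stage-13 datum of record), dag-n22-e's NAMED reading of record `readingOfRecord₁₃CoP w1 ℓ ne2 ne1` (`hpin := readingOfRecord₁₃CoP_ne3`, `rfl`), N05's CONJUNCTS AT THE PINNED ALL-TORUS PROPER SUB-INDEX** — the three content clauses
once per family give `S_N16Holder β (RRec₁₃CoP (readingOfRecord₁₃CoP w1 ℓ ne2 ne1))`; every other hypothesis a displayed letter line (module 33's per-family lemma, module 32's closer, the home's constant-layer iff). [folklore] -/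
theorem s_N16Holder_readingOfRecord₁₃CoP_of_window_linear_allTorus
    (hcontent : ∀ (F : T4Family), (∃ D : Datum F N, IsDatumOfRecord₁₃CCoP F N D) →
      letI : CStarAlgebra (Matrix (Fin N) (Fin N) ℂ) := {}
      B8.Thm4Body (c₁ F) (B₁' F) (fun i : {i : ZdIdx 4 F.L // (∀ j, i.Ω j = Set.univ) ∧ (∀ m j, i.Λs m j = {_y | j = m}) ∧ (∀ m j, i.Λb m j = {_c | j = m}) ∧ i.η = ((F.L : ℝ)⁻¹) ^ i.k} => (zdGF3 (Matrix (Fin N) (Fin N) ℂ) F.L β (len F) i.1).toGFData) ∧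
        B8.Prop3Body (cP F) 4 (F.L : ℝ) (C₂ F) (inp F) (B₀β F)
          (fun i : {i : ZdIdx 4 F.L // (∀ j, i.Ω j = Set.univ) ∧ (∀ m j, i.Λs m j = {_y | j = m}) ∧ (∀ m j, i.Λb m j = {_c | j = m}) ∧ i.η = ((F.L : ℝ)⁻¹) ^ i.k} => (zdGF3 (Matrix (Fin N) (Fin N) ℂ) F.L β (len F) i.1).toGFData2) ∧
        LeafH3sup 4 F.L (ne3NperOfRecord₁₁ F 0 0) (ℓ F).ε (b' F) (c' F) (ne3DomOfRecord₁₁ F N 0 0)) :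
    S_N16Holder β (RRec₁₃CoP (readingOfRecord₁₃CoP w1 ℓ ne2 ne1)) :=
  (s_N16Holder_rRec₁₃CoP_iff_of_constLayer β (readingOfRecord₁₃CoP w1 ℓ ne2 ne1) (fun F => ne3ConstLayerOfRecord₁₁ F N (ℓ F)) (readingOfRecord₁₃CoP_ne3 w1 ℓ ne2 ne1)).2 fun F hF =>
    have h := inEndRegimeH_and_leafSlotHolderAT_ofRecord_of_window_linear ℓ hlen hlen1 hB₁' hBB hc₁' hwin hα hα1 hα2 hα3 hα4 hα5 hg hε0 hε hΛ₁r hb hC hΛ₂' hb' hc' F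
      (hcontent F hF).1 (hcontent F hF).2.1 (hcontent F hF).2.2
    n16HolderAt_of_inEndRegimeH_leafSlotHolderAT h.1 hβ0 hβ1 h.2

end Holder

/-! ## §3 Multi-scale — `S_N16HolderMS β` (R-β″) -/

section MS

variable
  {len : T4Family → Site 4 → ℝ} {c₁ c₁' B₁' cP C₂ B₀β : T4Family → ℝ} {inp : T4Family → B8.B9Inputs} {α b' c' : T4Family → ℝ}
  (hlen : ∀ (F : T4Family) (v : Site 4), 0 < len F v → 1 ≤ len F v) (hlenj : ∀ (F : T4Family) (μ : Fin 4) (j : ℕ), len F (j • e μ) = j)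
  (hB₁' : ∀ F, 0 < B₁' F) (hBB : ∀ F : T4Family, 5 * ((4 : ℕ) : ℝ) * F.L * (inp F).B₀ ≤ B₁' F) (hc₁' : ∀ F, 0 < c₁' F)
  (hwin : ∀ (F : T4Family) (α₀ α₁ : ℝ), 0 < α₀ → 0 < α₁ → α₀ + α₁ ≤ c₁' F →
    α₀ + α₁ ≤ c₁ F ∧ C0 4 * (2 * α₀) ≤ 1 / 3 ∧ 4 * α₀ ≤ c2' 4 F.L ∧ 16 * (B₁' F * (α₀ + α₁)) ≤ 1 ∧
    Real.exp (4 * (800 * (((4 : ℕ) : ℝ) + 1) ^ 2 * (((4 : ℕ) : ℝ) + 4)) * α₀) * (1 + 8 * (131072 * (((4 : ℕ) : ℝ) + 1) ^ 2) * (B₁' F * (α₀ + α₁))) ≤ 2 ∧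
    2 * (B₁' F * (α₀ + α₁)) ≤ c3 4 F.L ∧ ((4 : ℕ) : ℝ) * F.L * α₁ ≤ 1 / 8 ∧ α₀ ≤ cP F ∧ α₁ ≤ cP F ∧ B₁' F * (α₀ + α₁) ≤ cP F ∧
    2 * (B₁' F * (α₀ + α₁)) ^ 2 + 20 * ((4 : ℕ) : ℝ) * α₀ * (B₁' F * (α₀ + α₁)) + 2 * C₂ F * (B₁' F * (α₀ + α₁)) ^ 2 ≤ α₀ + α₁)
  (hα : ∀ F, 0 < α F) (hα1 : ∀ F, α F ≤ c₁' F / 177)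
  (hα2 : ∀ F : T4Family, α F ≤ (ℓ F).Λ₁ / (1770 * (5 * ((4 : ℕ) : ℝ) * F.L * (inp F).B₀) + 1))
  (hα3 : ∀ F : T4Family, α F ≤ c2' 4 F.L / 2)
  (hα4 : ∀ F : T4Family, α F ≤ 1 / ((23040 * (4 : ℝ) ^ 4 * (frameC 4 F.L + 4) ^ 3 + 12) * (1 + curConst 4 F.L) + 1))
  (hα5 : ∀ F, α F ≤ 1 / 10 ^ 9)
  (hg : ∀ F, 0 < (ℓ F).g) (hε0 : ∀ F, 0 < (ℓ F).ε) (hε : ∀ F, (ℓ F).ε < α F)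
  (hΛ₁r : ∀ F : T4Family, (ℓ F).Λ₁ ≤ radiusOfRecordHMS N F.L (ne3NperOfRecord₁₁ F 0 0))
  (hb : ∀ F, 0 ≤ (ℓ F).b ∧ (ℓ F).b ≤ (ℓ F).ε / 2) (hC : ∀ F : T4Family, constOfRecordHMS N F.L (ne3NperOfRecord₁₁ F 0 0) (ℓ F).g ≤ (ℓ F).C)
  (hΛ₂' : ∀ F : T4Family, 177 * α F * (5 * ((4 : ℕ) : ℝ) * F.L * B₀β F + 5 * ((4 : ℕ) : ℝ) * F.L * (inp F).B₀) ≤ (ℓ F).Λ₂')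
  (hb' : ∀ F, 0 ≤ b' F ∧ b' F ≤ α F / 2048) (hc' : ∀ F, 0 ≤ c' F ∧ c' F ≤ α F / 24)
include hpin hlen hlenj hB₁' hBB hc₁' hwin hα hα1 hα2 hα3 hα4 hα5 hg hε0 hε hΛ₁r hb hC hΛ₂' hb' hc'

variable (hβ0 : 0 ≤ β) (hβ1 : β ≤ 1)
include hβ0 hβ1

/-- ★ **THE MS N16 LINE (R-β″, `S_N16HolderMS β`) AT THE REGIME-RESTRICTED home (content once per GUARDED family carrying an admissible tuple), a reading `𝔯` pinned at RR-1's object of record (`hpin`), N05's CONJUNCTS AT THE PINNED ALL-TORUS PROPER SUB-INDEX** — the three content clauses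
once per family give `S_N16HolderMS β (RRec₁₃CoPOn 𝔯 Rg)`; every other hypothesis a displayed letter line (module 33's per-family lemma, module 32's closer, the home's constant-layer iff). [folklore] -/
theorem s_N16HolderMS_rRec₁₃CoPOn_ofRecord_of_window_linear_allTorus
    (hcontent : ∀ (F : T4Family), (∃ θ : Stage13Params F N, θ.Provisos₁₃Core F N ∧ Rg F θ ∧ θ.Admissible F N) →
      letI : CStarAlgebra (Matrix (Fin N) (Fin N) ℂ) := {}
      B8.Thm4Body (c₁ F) (B₁' F) (fun i : {i : ZdIdx 4 F.L // (∀ j, i.Ω j = Set.univ) ∧ (∀ m j, i.Λs m j = {_y | j = m}) ∧ (∀ m j, i.Λb m j = {_c | j = m}) ∧ i.η = ((F.L : ℝ)⁻¹) ^ i.k} => (zdGF3 (Matrix (Fin N) (Fin N) ℂ) F.L β (len F) i.1).toGFData) ∧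
        B8.Prop3Body (cP F) 4 (F.L : ℝ) (C₂ F) (inp F) (B₀β F)
          (fun i : {i : ZdIdx 4 F.L // (∀ j, i.Ω j = Set.univ) ∧ (∀ m j, i.Λs m j = {_y | j = m}) ∧ (∀ m j, i.Λb m j = {_c | j = m}) ∧ i.η = ((F.L : ℝ)⁻¹) ^ i.k} => (zdGF3 (Matrix (Fin N) (Fin N) ℂ) F.L β (len F) i.1).toGFData2) ∧
        LeafH3sup 4 F.L (ne3NperOfRecord₁₁ F 0 0) (ℓ F).ε (b' F) (c' F) (ne3DomOfRecord₁₁ F N 0 0)) :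
    S_N16HolderMS β (RRec₁₃CoPOn 𝔯 Rg) :=
  (s_N16HolderMS_rRec₁₃CoPOn_iff_ofRecord β 𝔯 Rg ℓ hpin).2 fun F hF =>
    have h := inEndRegimeHMS_and_leafSlotHolderMSAT_ofRecord_of_window_linear ℓ hlen hlenj hB₁' hBB hc₁' hwin hα hα1 hα2 hα3 hα4 hα5 hg hε0 hε hΛ₁r hb hC hΛ₂' hb' hc' F
      (hcontent F hF).1 (hcontent F hF).2.1 (hcontent F hF).2.2
    n16HolderMSAt_of_inEndRegimeHMS_leafSlotHolderMSAT h.1 hβ0 hβ1 h.2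

/-- ★ **THE MS N16 LINE (R-β″, `S_N16HolderMS β`) AT THE CANONICAL home (content once per family carrying a Stage-13 datum of record), a reading `𝔯` pinned at RR-1's object of record (`hpin`), N05's CONJUNCTS AT THE PINNED ALL-TORUS PROPER SUB-INDEX** — the three content clauses
once per family give `S_N16HolderMS β (RRec₁₃CoP 𝔯)`; every other hypothesis a displayed letter line (module 33's per-family lemma, module 32's closer, the home's constant-layer iff). [folklore] -/
theorem s_N16HolderMS_rRec₁₃CoP_ofRecord_of_window_linear_allTorus
    (hcontent : ∀ (F : T4Family), (∃ D : Datum F N, IsDatumOfRecord₁₃CCoP F N D) →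
      letI : CStarAlgebra (Matrix (Fin N) (Fin N) ℂ) := {}
      B8.Thm4Body (c₁ F) (B₁' F) (fun i : {i : ZdIdx 4 F.L // (∀ j, i.Ω j = Set.univ) ∧ (∀ m j, i.Λs m j = {_y | j = m}) ∧ (∀ m j, i.Λb m j = {_c | j = m}) ∧ i.η = ((F.L : ℝ)⁻¹) ^ i.k} => (zdGF3 (Matrix (Fin N) (Fin N) ℂ) F.L β (len F) i.1).toGFData) ∧
        B8.Prop3Body (cP F) 4 (F.L : ℝ) (C₂ F) (inp F) (B₀β F)
          (fun i : {i : ZdIdx 4 F.L // (∀ j, i.Ω j = Set.univ) ∧ (∀ m j, i.Λs m j = {_y | j = m}) ∧ (∀ m j, i.Λb m j = {_c | j = m}) ∧ i.η = ((F.L : ℝ)⁻¹) ^ i.k} => (zdGF3 (Matrix (Fin N) (Fin N) ℂ) F.L β (len F) i.1).toGFData2) ∧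
        LeafH3sup 4 F.L (ne3NperOfRecord₁₁ F 0 0) (ℓ F).ε (b' F) (c' F) (ne3DomOfRecord₁₁ F N 0 0)) :
    S_N16HolderMS β (RRec₁₃CoP 𝔯) :=
  (s_N16HolderMS_rRec₁₃CoP_iff_ofRecord β 𝔯 ℓ hpin).2 fun F hF =>
    have h := inEndRegimeHMS_and_leafSlotHolderMSAT_ofRecord_of_window_linear ℓ hlen hlenj hB₁' hBB hc₁' hwin hα hα1 hα2 hα3 hα4 hα5 hg hε0 hε hΛ₁r hb hC hΛ₂' hb' hc' F
      (hcontent F hF).1 (hcontent F hF).2.1 (hcontent F hF).2.2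
    n16HolderMSAt_of_inEndRegimeHMS_leafSlotHolderMSAT h.1 hβ0 hβ1 h.2

omit hpin in
/-- ★ **THE MS N16 LINE (R-β″, `S_N16HolderMS β`) AT THE REGIME-RESTRICTED home (content once per GUARDED family carrying an admissible tuple), dag-n22-e's NAMED reading of record `readingOfRecord₁₃CoP w1 ℓ ne2 ne1` (`hpin := readingOfRecord₁₃CoP_ne3`, `rfl`), N05's CONJUNCTS AT THE PINNED ALL-TORUS PROPER SUB-INDEX** — the three content clauses
once per family give `S_N16HolderMS β (RRec₁₃CoPOn (readingOfRecord₁₃CoP w1 ℓ ne2 ne1) Rg)`; every other hypothesis a displayed letter line (module 33's per-family lemma, module 32's closer, the home's constant-layer iff). [folklore] -/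
theorem s_N16HolderMS_readingOfRecord₁₃CoPOn_of_window_linear_allTorus
    (hcontent : ∀ (F : T4Family), (∃ θ : Stage13Params F N, θ.Provisos₁₃Core F N ∧ Rg F θ ∧ θ.Admissible F N) →
      letI : CStarAlgebra (Matrix (Fin N) (Fin N) ℂ) := {}
      B8.Thm4Body (c₁ F) (B₁' F) (fun i : {i : ZdIdx 4 F.L // (∀ j, i.Ω j = Set.univ) ∧ (∀ m j, i.Λs m j = {_y | j = m}) ∧ (∀ m j, i.Λb m j = {_c | j = m}) ∧ i.η = ((F.L : ℝ)⁻¹) ^ i.k} => (zdGF3 (Matrix (Fin N) (Fin N) ℂ) F.L β (len F) i.1).toGFData) ∧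
        B8.Prop3Body (cP F) 4 (F.L : ℝ) (C₂ F) (inp F) (B₀β F)
          (fun i : {i : ZdIdx 4 F.L // (∀ j, i.Ω j = Set.univ) ∧ (∀ m j, i.Λs m j = {_y | j = m}) ∧ (∀ m j, i.Λb m j = {_c | j = m}) ∧ i.η = ((F.L : ℝ)⁻¹) ^ i.k} => (zdGF3 (Matrix (Fin N) (Fin N) ℂ) F.L β (len F) i.1).toGFData2) ∧
        LeafH3sup 4 F.L (ne3NperOfRecord₁₁ F 0 0) (ℓ F).ε (b' F) (c' F) (ne3DomOfRecord₁₁ F N 0 0)) :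
    S_N16HolderMS β (RRec₁₃CoPOn (readingOfRecord₁₃CoP w1 ℓ ne2 ne1) Rg) :=
  (s_N16HolderMS_rRec₁₃CoPOn_iff_ofRecord β (readingOfRecord₁₃CoP w1 ℓ ne2 ne1) Rg ℓ (readingOfRecord₁₃CoP_ne3 w1 ℓ ne2 ne1)).2 fun F hF =>
    have h := inEndRegimeHMS_and_leafSlotHolderMSAT_ofRecord_of_window_linear ℓ hlen hlenj hB₁' hBB hc₁' hwin hα hα1 hα2 hα3 hα4 hα5 hg hε0 hε hΛ₁r hb hC hΛ₂' hb' hc' F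
      (hcontent F hF).1 (hcontent F hF).2.1 (hcontent F hF).2.2
    n16HolderMSAt_of_inEndRegimeHMS_leafSlotHolderMSAT h.1 hβ0 hβ1 h.2

omit hpin in
/-- ★ **THE MS N16 LINE (R-β″, `S_N16HolderMS β`) AT THE CANONICAL home (content once per family carrying a Stage-13 datum of record), dag-n22-e's NAMED reading of record `readingOfRecord₁₃CoP w1 ℓ ne2 ne1` (`hpin := readingOfRecord₁₃CoP_ne3`, `rfl`), N05's CONJUNCTS AT THE PINNED ALL-TORUS PROPER SUB-INDEX** — the three content clauses
once per family give `S_N16HolderMS β (RRec₁₃CoP (readingOfRecord₁₃CoP w1 ℓ ne2 ne1))`; every other hypothesis a displayed letter line (module 33's per-family lemma, module 32's closer, the home's constant-layer iff). [folklore] -/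
theorem s_N16HolderMS_readingOfRecord₁₃CoP_of_window_linear_allTorus
    (hcontent : ∀ (F : T4Family), (∃ D : Datum F N, IsDatumOfRecord₁₃CCoP F N D) →
      letI : CStarAlgebra (Matrix (Fin N) (Fin N) ℂ) := {}
      B8.Thm4Body (c₁ F) (B₁' F) (fun i : {i : ZdIdx 4 F.L // (∀ j, i.Ω j = Set.univ) ∧ (∀ m j, i.Λs m j = {_y | j = m}) ∧ (∀ m j, i.Λb m j = {_c | j = m}) ∧ i.η = ((F.L : ℝ)⁻¹) ^ i.k} => (zdGF3 (Matrix (Fin N) (Fin N) ℂ) F.L β (len F) i.1).toGFData) ∧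
        B8.Prop3Body (cP F) 4 (F.L : ℝ) (C₂ F) (inp F) (B₀β F)
          (fun i : {i : ZdIdx 4 F.L // (∀ j, i.Ω j = Set.univ) ∧ (∀ m j, i.Λs m j = {_y | j = m}) ∧ (∀ m j, i.Λb m j = {_c | j = m}) ∧ i.η = ((F.L : ℝ)⁻¹) ^ i.k} => (zdGF3 (Matrix (Fin N) (Fin N) ℂ) F.L β (len F) i.1).toGFData2) ∧
        LeafH3sup 4 F.L (ne3NperOfRecord₁₁ F 0 0) (ℓ F).ε (b' F) (c' F) (ne3DomOfRecord₁₁ F N 0 0)) :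
    S_N16HolderMS β (RRec₁₃CoP (readingOfRecord₁₃CoP w1 ℓ ne2 ne1)) :=
  (s_N16HolderMS_rRec₁₃CoP_iff_ofRecord β (readingOfRecord₁₃CoP w1 ℓ ne2 ne1) ℓ (readingOfRecord₁₃CoP_ne3 w1 ℓ ne2 ne1)).2 fun F hF =>
    have h := inEndRegimeHMS_and_leafSlotHolderMSAT_ofRecord_of_window_linear ℓ hlen hlenj hB₁' hBB hc₁' hwin hα hα1 hα2 hα3 hα4 hα5 hg hε0 hε hΛ₁r hb hC hΛ₂' hb' hc' F
      (hcontent F hF).1 (hcontent F hF).2.1 (hcontent F hF).2.2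
    n16HolderMSAt_of_inEndRegimeHMS_leafSlotHolderMSAT h.1 hβ0 hβ1 h.2

end MS

end

end Summit.QuantumFields.YangMills.BalabanUVNodes.N16LinesAllTorusAtRecord13CoP
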